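import Summits.AtomisticToContinuum.Crystallization.Theorems.OverbindingBudgetAffineFarFieldFrameTransport

/-!
# Overbinding budget — far field, part 27V-F1 «FrameRows»: the declared per-bond row shape, stated once

Route `OverbindingBudget`, crux `RobustDefectLimitWindows` (stmt-31280), line (2c), leaf SW♭(30),
part 27V-F (FRAME LEDGER), piece F1 — the DECLARED SHAPE of the per-bond hypotheses that the atlas
(27Vc) discharges and that F2 «FrameTransport» consumes, with the smoothness constant `c` stated ONCE
(critic r1722 (κ)).  Generic and DEF-FREE; the explicit pattern isometries are the atlas's.

THE SHAPE.  A registered path `p₀, …, p_L` carries per site a chart `A k : E →L[ℝ] E` (the desk's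
`M_p = ν_p A_p`, scale absorbed) mapping the site's OWN pattern frame onto its actual star, and per
bond a PATTERN ISOMETRY `P k` re-expressing `p_k`'s pattern frame in `p_{k+1}`'s (fcc translation
class: the identity; hcp / Barlow layer-type change: the half-turn about the stacking axis, which acts
on the `σ_h`-symmetric patterns and cells as `−id` does; all explicit, norm-preserving, closed under
composition).  The
PER-BOND ROW is `‖A (k+1) ∘ P k − A k‖ ≤ c` (one numeral `c` for every bond class, of record
`c = 2.9e-4·ν`, DESK27V-g94 §3 (L); its derivation from the hub's shape drift `θ₁` and spacing drift
`δν` is `bond_row_of_scale_shape`: `c := ν_max·θ₁ + δν·a`).  The TRANSPORTED CHART is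
`M k := A k ∘ Q k` with `Q 0 = id`, `Q (k+1) = P k ∘ Q k`; then `‖M (k+1) − M k‖ ≤ c` (`frame_rows`),
`|det (M k)| = |det (A k)|` (`abs_det_comp_eq_of_norm_eq`), the position steps keep their template
norms (`position_step_of_bond`, `norm_apply_inverse_eq`), and F2's three clauses follow along the path
with CLOSED-FORM accumulation (`frame_ledger`: matrix `≤ L·c`, determinant `(a − Lc)³ ≤ |det A_L| ≤
(‖A₀‖ + Lc)³`, position `≤ c·τ·L(L−1)/2 + L·η`).  The hub chart's conformality clause (CellVoronoi's
`hB`) yields the binders `a` and `‖A 0‖ ≤ b` (`lower_norm_of_conformal`, `opNorm_le_of_conformal`).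

Docstring table (not load-bearing): θ₀ = 1e-3 (chart anisotropy), ε = 1e-4 ν (misplacement),
c = 2.9e-4 ν per bond, τ = ν (pattern bonds), η = 2ε, L = bond-graph distance from the hub along the
registered path (DESK27V-g94 §3, CERTSHAPES-g96); must-fails MF22 (isometry of `P k` dropped) and
MF23 (spacing-drift term dropped from the row).
-/

namespace Summit.AtomisticToContinuum.Crystallization.Theorems.OverbindingBudgetAffineFarFieldFrameRows

noncomputable section

open Summit.AtomisticToContinuum.Crystallization.Theorems.OverbindingBudgetAffineFarFieldFrameTransport

local notation "E3" => EuclideanSpace ℝ (Fin 3)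

/-! ## §1 Rows over a general normed space -/

section Generic

variable {E : Type*} [NormedAddCommGroup E] [NormedSpace ℝ E]

/-- Composing with a norm-preserving map does not increase the operator norm. -/
theorem opNorm_comp_le_of_norm_eq (X Q : E →L[ℝ] E) (hQ : ∀ u, ‖Q u‖ = ‖u‖) : ‖X.comp Q‖ ≤ ‖X‖ := by
  refine ContinuousLinearMap.opNorm_le_bound _ (norm_nonneg X) fun u => ?_
  rw [ContinuousLinearMap.comp_apply, ← hQ u]
  exact X.le_opNorm (Q u)

/-- A composite of norm-preserving maps along the path is norm-preserving:
`Q 0 = id`, `Q (k+1) = P k ∘ Q k`, every `P k` norm-preserving ⇒ every `Q k`, `k ≤ L`, is. -/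
theorem norm_apply_eq_of_rec (P Q : ℕ → E →L[ℝ] E) {L : ℕ} (hQ0 : Q 0 = ContinuousLinearMap.id ℝ E)
    (hQ : ∀ k < L, Q (k + 1) = (P k).comp (Q k)) (hP : ∀ k < L, ∀ u, ‖P k u‖ = ‖u‖) :
    ∀ k ≤ L, ∀ u, ‖Q k u‖ = ‖u‖ := by
  intro k hk
  induction k with
  | zero => intro u; rw [hQ0]; rfl
  | succ k ih =>
    intro u
    have hk' : k < L := Nat.lt_of_succ_le hk
    rw [hQ k hk', ContinuousLinearMap.comp_apply, hP k hk', ih hk'.le]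

/-- THE DECLARED ROW FROM THE HUB'S TWO DRIFTS (the one place `c` is produced): shape drift
`‖A₁ ∘ P − A₀‖ ≤ θ₁`, spacing drift `|ν₁ − ν₀| ≤ δν`, `|ν₁| ≤ ν_max`, `‖A₀‖ ≤ a` ⇒
`‖(ν₁ • A₁) ∘ P − ν₀ • A₀‖ ≤ ν_max·θ₁ + δν·a =: c`. -/
theorem bond_row_of_scale_shape (A₀ A₁ P : E →L[ℝ] E) {ν₀ ν₁ θ₁ δν νmax a : ℝ}
    (hA : ‖A₁.comp P - A₀‖ ≤ θ₁) (hν : |ν₁ - ν₀| ≤ δν) (hν₁ : |ν₁| ≤ νmax) (hA₀ : ‖A₀‖ ≤ a) :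
    ‖(ν₁ • A₁).comp P - ν₀ • A₀‖ ≤ νmax * θ₁ + δν * a := by
  have e : (ν₁ • A₁).comp P - ν₀ • A₀ = ν₁ • (A₁.comp P - A₀) + (ν₁ - ν₀) • A₀ := by
    rw [ContinuousLinearMap.smul_comp, smul_sub, sub_smul]; abel
  rw [e]
  refine (norm_add_le _ _).trans (add_le_add ?_ ?_)
  · rw [norm_smul, Real.norm_eq_abs]
    exact mul_le_mul hν₁ hA (norm_nonneg _) ((abs_nonneg _).trans hν₁)
  · rw [norm_smul, Real.norm_eq_abs]
    exact mul_le_mul hν (hA₀) (norm_nonneg _) ((abs_nonneg _).trans hν)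

/-- FRAME ROWS: the per-bond rows `‖A (k+1) ∘ P k − A k‖ ≤ c` become F2's steps
`‖M (k+1) − M k‖ ≤ c` for the transported chart `M k := A k ∘ Q k`. -/
theorem frame_rows (A P Q : ℕ → E →L[ℝ] E) {c : ℝ} {L : ℕ}
    (hrow : ∀ k < L, ‖(A (k + 1)).comp (P k) - A k‖ ≤ c)
    (hQ : ∀ k < L, Q (k + 1) = (P k).comp (Q k)) (hQn : ∀ k < L, ∀ u, ‖Q k u‖ = ‖u‖) :
    ∀ k < L, ‖(A (k + 1)).comp (Q (k + 1)) - (A k).comp (Q k)‖ ≤ c := by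
  intro k hk
  have e : (A (k + 1)).comp (Q (k + 1)) - (A k).comp (Q k) = ((A (k + 1)).comp (P k) - A k).comp (Q k) := by
    rw [hQ k hk, ContinuousLinearMap.sub_comp, ContinuousLinearMap.comp_assoc]
  rw [e]
  exact (opNorm_comp_le_of_norm_eq _ _ (hQn k hk)).trans (hrow k hk)

/-- A right inverse of a norm-preserving map preserves norms. -/
theorem norm_apply_inverse_eq (Q Qi : E →L[ℝ] E) (hQn : ∀ u, ‖Q u‖ = ‖u‖) (hQi : ∀ u, Q (Qi u) = u)
    (b : E) : ‖Qi b‖ = ‖b‖ := by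
  rw [← hQn (Qi b), hQi]

/-- POSITION STEP in the transported chart: `y' = y + A b + e` reads `y' = y + (A ∘ Q)(Q⁻¹ b) + e`. -/
theorem position_step_of_bond (A Q Qi : E →L[ℝ] E) {y y' b e : E} (hQi : ∀ u, Q (Qi u) = u)
    (h : y' = y + A b + e) : y' = y + (A.comp Q) (Qi b) + e := by
  rw [ContinuousLinearMap.comp_apply, hQi]; exact h

end Generic

/-! ## §2 Determinant and conformality rows on `ℝ³` -/

/-- A norm-preserving linear map of `ℝ³` has `|det| = 1` (Haar-measure sandwich of F2, both ways). -/
theorem abs_det_eq_one_of_norm_eq (Q : E3 →L[ℝ] E3) (hQ : ∀ u, ‖Q u‖ = ‖u‖) : |Q.det| = 1 := by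
  have h1 : (1 : ℝ) ^ 3 ≤ |Q.det| := pow_le_abs_det Q zero_le_one fun u => by rw [one_mul, hQ u]
  have h2 : |Q.det| ≤ (1 : ℝ) ^ 3 :=
    abs_det_le_pow Q (ContinuousLinearMap.opNorm_le_bound _ zero_le_one fun u => by rw [one_mul, hQ u])
  rw [one_pow] at h1 h2
  exact le_antisymm h2 h1

/-- The transported chart has the volume factor of the site's own chart: `|det (A ∘ Q)| = |det A|`. -/
theorem abs_det_comp_eq_of_norm_eq (A Q : E3 →L[ℝ] E3) (hQ : ∀ u, ‖Q u‖ = ‖u‖) :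
    |(A.comp Q).det| = |A.det| := by
  have e : (A.comp Q).det = A.det * Q.det := by
    unfold ContinuousLinearMap.det
    rw [← LinearMap.det_comp]; rfl
  rw [e, abs_mul, abs_det_eq_one_of_norm_eq Q hQ, mul_one]

/-- LOWER ROW of a conformal chart (CellVoronoi's `hB`): `a² ≤ (1 − m)λ²`, `0 ≤ a` ⇒ `a‖u‖ ≤ ‖A u‖`. -/
theorem lower_norm_of_conformal (A : E3 →L[ℝ] E3) {lam m a : ℝ}
    (hB : ∀ u w : E3, |inner ℝ (A u) (A w) - lam ^ 2 * inner ℝ u w| ≤ m * lam ^ 2 * ‖u‖ * ‖w‖)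
    (ha0 : 0 ≤ a) (ha : a ^ 2 ≤ (1 - m) * lam ^ 2) : ∀ u, a * ‖u‖ ≤ ‖A u‖ := by
  intro u
  have h1 := hB u u
  rw [real_inner_self_eq_norm_sq, real_inner_self_eq_norm_sq] at h1
  have hsq : (a * ‖u‖) ^ 2 ≤ ‖A u‖ ^ 2 := by
    rw [mul_pow]; nlinarith [abs_le.1 h1, norm_nonneg u, sq_nonneg ‖u‖]
  exact (pow_le_pow_iff_left₀ (mul_nonneg ha0 (norm_nonneg u)) (norm_nonneg _) two_ne_zero).1 hsq

/-- UPPER ROW of a conformal chart: `(1 + m)λ² ≤ b²`, `0 ≤ b` ⇒ `‖A‖ ≤ b`. -/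
theorem opNorm_le_of_conformal (A : E3 →L[ℝ] E3) {lam m b : ℝ}
    (hB : ∀ u w : E3, |inner ℝ (A u) (A w) - lam ^ 2 * inner ℝ u w| ≤ m * lam ^ 2 * ‖u‖ * ‖w‖)
    (hb0 : 0 ≤ b) (hb : (1 + m) * lam ^ 2 ≤ b ^ 2) : ‖A‖ ≤ b := by
  refine ContinuousLinearMap.opNorm_le_bound A hb0 fun u => ?_
  have h1 := hB u u
  rw [real_inner_self_eq_norm_sq, real_inner_self_eq_norm_sq] at h1
  have hsq : ‖A u‖ ^ 2 ≤ (b * ‖u‖) ^ 2 := by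
    rw [mul_pow]; nlinarith [abs_le.1 h1, norm_nonneg u, sq_nonneg ‖u‖]
  exact (pow_le_pow_iff_left₀ (norm_nonneg _) (mul_nonneg hb0 (norm_nonneg u)) two_ne_zero).1 hsq

/-! ## §3 The frame ledger along a registered path: F1's rows fed through F2's three clauses -/

/-- FRAME LEDGER (F1 → F2, closed form).  Per-bond rows `‖A (k+1) ∘ P k − A k‖ ≤ c` with norm-preserving
pattern isometries `P k` (right inverses `Pi k`), composites `Q 0 = id`, `Q (k+1) = P k ∘ Q k` (right
inverses `Qi k`), position steps `y (k+1) = y k + A k (b k) + e k` with template bonds `‖b k‖ ≤ τ` and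
misplacements `‖e k‖ ≤ η`, and the hub chart's lower row `a‖u‖ ≤ ‖A 0 u‖` with `L·c ≤ a` ⇒ at the
end of the path: MATRIX `‖A L ∘ Q L − A 0‖ ≤ L·c`; DETERMINANT `(a − Lc)³ ≤ |det (A L)| ≤ (‖A 0‖ + Lc)³`
(the site's OWN chart — the isometry is stripped); POSITION
`‖y L − y 0 − A 0 (Σ_{k<L} Qi k (b k))‖ ≤ c·τ·L(L−1)/2 + L·η`. -/
theorem frame_ledger (A P Q Qi : ℕ → E3 →L[ℝ] E3) (y b e : ℕ → E3) {c τ η a : ℝ} {L : ℕ}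
    (hrow : ∀ k < L, ‖(A (k + 1)).comp (P k) - A k‖ ≤ c)
    (hP : ∀ k < L, ∀ u, ‖P k u‖ = ‖u‖)
    (hQ0 : Q 0 = ContinuousLinearMap.id ℝ E3) (hQ : ∀ k < L, Q (k + 1) = (P k).comp (Q k))
    (hQi : ∀ k < L, ∀ u, Q k (Qi k u) = u)
    (hstep : ∀ k < L, y (k + 1) = y k + A k (b k) + e k) (hb : ∀ k < L, ‖b k‖ ≤ τ)
    (he : ∀ k < L, ‖e k‖ ≤ η) (h0 : ∀ u, a * ‖u‖ ≤ ‖A 0 u‖) (hLc : L * c ≤ a) :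
    ‖(A L).comp (Q L) - A 0‖ ≤ L * c ∧
    ((a - L * c) ^ 3 ≤ |(A L).det| ∧ |(A L).det| ≤ (‖A 0‖ + L * c) ^ 3) ∧
    ‖y L - y 0 - A 0 (∑ k ∈ Finset.range L, Qi k (b k))‖ ≤ c * τ * (L * ((L : ℝ) - 1) / 2) + L * η := by
  have hQn : ∀ k ≤ L, ∀ u, ‖Q k u‖ = ‖u‖ := norm_apply_eq_of_rec P Q hQ0 hQ hP
  have hM : ∀ k < L, ‖(A (k + 1)).comp (Q (k + 1)) - (A k).comp (Q k)‖ ≤ c :=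
    frame_rows A P Q hrow hQ fun k hk => hQn k hk.le
  have hM0 : (A 0).comp (Q 0) = A 0 := by rw [hQ0, ContinuousLinearMap.comp_id]
  -- the transported chart
  set M : ℕ → E3 →L[ℝ] E3 := fun k => (A k).comp (Q k) with hMdef
  have hM' : ∀ k < L, ‖M (k + 1) - M k‖ ≤ c := hM
  have hM0' : M 0 = A 0 := hM0
  refine ⟨?_, ?_, ?_⟩
  · have h := transport_linear_le M hM' le_rfl
    rwa [hM0'] at h
  · have h0' : ∀ u, a * ‖u‖ ≤ ‖M 0 u‖ := by rw [hM0']; exact h0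
    have h := det_clause_of_steps M h0' hM' le_rfl hLc
    rw [hM0'] at h
    have e : |(M L).det| = |(A L).det| := abs_det_comp_eq_of_norm_eq (A L) (Q L) (hQn L le_rfl)
    rwa [e] at h
  · have hstep' : ∀ k < L, y (k + 1) = y k + M k (Qi k (b k)) + e k := fun k hk =>
      position_step_of_bond (A k) (Q k) (Qi k) (hQi k hk) (hstep k hk)
    have ht : ∀ k < L, ‖Qi k (b k)‖ ≤ τ := fun k hk => by
      rw [norm_apply_inverse_eq (Q k) (Qi k) (hQn k hk.le) (hQi k hk)]; exact hb k hk
    have h := position_clause_closed M y (fun k => Qi k (b k)) e hstep' ht he hM'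
    rwa [hM0'] at h

end

end Summit.AtomisticToContinuum.Crystallization.Theorems.OverbindingBudgetAffineFarFieldFrameRows
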